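import Summits.QuantumAdvantage.QuantumAdvantage.Theorems.CubicForrelationSignedCubicForrelationInPrBPPStubHeredity
import Mathlib.Data.Matrix.Mul

/-!
# Crux `CubicForrelation.SignedExactCubicForrelationNotPrBPP` (stmt-QuantumAdvantage-13932), line `dual-pingpong-frame`

Helper toward the open stub `stub_finder`: **soundness of the two-tensor orbit step.** For trilinear forms `T` (of `b`) and
`T'` (of `a`) on `𝔽₂ⁿ`, symmetric in the first two slots, with `T` isotropic on `E` and `T'` isotropic on the dot-product
annihilator `E'` of `E` (and `E = E'^⊥`, automatic in the half-dimensional case), every slice of `T` sends `E` into `E'`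
and every slice of `T'` sends `E'` back into `E`; hence `E` is invariant under all the operators `A_z ∘ B_w`
(`B_w e := T(e, w, ·)`, `A_z x := T'(x, z, ·)`, functionals read as vectors through the standard basis). This is what keeps
the ping-pong / algebra-orbit closure of a TRUE seed inside the hidden M-subspace.
-/

noncomputable section

set_option linter.dupNamespace false -- D-0017: single-problem summit ⇒ `QuantumAdvantage.QuantumAdvantage` by design

namespace Summit.QuantumAdvantage.QuantumAdvantage.Theorems.SignedExactCubicForrelationNotPrBPP.Finder

open scoped Matrix

/-- A linear functional `φ` on `𝔽₂ⁿ` read as the vector `(φ eᵢ)ᵢ` through the standard basis pairs with `x` to `φ x`. [folklore] -/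
theorem vecOf_dotProduct {n : ℕ} (φ : (Fin n → ZMod 2) →ₗ[ZMod 2] ZMod 2) (x : Fin n → ZMod 2) :
    (fun i => φ (Pi.single i 1)) ⬝ᵥ x = φ x := by
  have hx : x = ∑ i, x i • (Pi.single i 1 : Fin n → ZMod 2) := by
    ext j
    simp [Finset.sum_apply, Pi.single_apply, Finset.sum_ite_eq]
  conv_rhs => rw [hx]
  rw [map_sum]
  simp only [dotProduct, map_smul, smul_eq_mul]
  exact Finset.sum_congr rfl fun i _ => mul_comm _ _

/-- **Slices send the isotropic subspace into its annihilator.** If `T` is symmetric in its last two slots (`T u v w = T u w v`)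
and isotropic on `E` (`T(E,E,·)=0`), then for `e ∈ E` and any `w` the vector `(T(e, w, eᵢ))ᵢ` of the
functional `T(e, w, ·)` is dot-orthogonal to `E`. [folklore] -/
theorem vecOf_slice_orthogonal {n : ℕ}
    (T : (Fin n → ZMod 2) →ₗ[ZMod 2] (Fin n → ZMod 2) →ₗ[ZMod 2] (Fin n → ZMod 2) →ₗ[ZMod 2] ZMod 2)
    (E : Submodule (ZMod 2) (Fin n → ZMod 2))
    (hsym₂ : ∀ u v w, T u v w = T u w v) (hiso : ∀ e ∈ E, ∀ e' ∈ E, ∀ w, T e e' w = 0)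
    {e : Fin n → ZMod 2} (he : e ∈ E) (w : Fin n → ZMod 2) :
    ∀ x ∈ E, (fun i => T e w (Pi.single i 1)) ⬝ᵥ x = 0 := by
  intro x hx
  rw [vecOf_dotProduct, hsym₂]
  exact hiso e he x hx w

/-- **Orbit-step soundness.** `T` (for `b`) isotropic on `E`, `T'` (for `a`) isotropic on `E'`, both symmetric in their last two
slots, where `E'` contains every vector dot-orthogonal to `E` and `E` contains every vector dot-orthogonal to `E'` (for a
half-dimensional M-subspace pair `(V, V^⊥)` both hold). Then for `e ∈ E` and all `w z`, the vector
`A_z (B_w e) := (T'(B_w e, z, eᵢ))ᵢ` with `B_w e := (T(e, w, eⱼ))ⱼ` lies in `E` again. [folklore] -/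
theorem orbit_step_mem {n : ℕ}
    (T T' : (Fin n → ZMod 2) →ₗ[ZMod 2] (Fin n → ZMod 2) →ₗ[ZMod 2] (Fin n → ZMod 2) →ₗ[ZMod 2] ZMod 2)
    (E E' : Submodule (ZMod 2) (Fin n → ZMod 2))
    (hsym₂ : ∀ u v w, T u v w = T u w v) (hsym₂' : ∀ u v w, T' u v w = T' u w v)
    (hiso : ∀ e ∈ E, ∀ e' ∈ E, ∀ w, T e e' w = 0) (hiso' : ∀ x ∈ E', ∀ x' ∈ E', ∀ w, T' x x' w = 0)
    (hE' : ∀ y, (∀ x ∈ E, y ⬝ᵥ x = 0) → y ∈ E') (hE : ∀ v, (∀ y ∈ E', v ⬝ᵥ y = 0) → v ∈ E)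
    {e : Fin n → ZMod 2} (he : e ∈ E) (w z : Fin n → ZMod 2) :
    (fun i => T' (fun j => T e w (Pi.single j 1)) z (Pi.single i 1)) ∈ E := by
  have h1 : (fun j => T e w (Pi.single j 1)) ∈ E' := hE' _ (vecOf_slice_orthogonal T E hsym₂ hiso he w)
  exact hE _ (vecOf_slice_orthogonal T' E' hsym₂' hiso' h1 z)

end Summit.QuantumAdvantage.QuantumAdvantage.Theorems.SignedExactCubicForrelationNotPrBPP.Finder

end
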